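import Summits.Schanuel.Schanuel.Theorems.ZilberEacFibration
import HarnessLib

/-!
# The fibration principle, II: density read on the projected variety itself

Zilber's Exponential-Algebraic Closedness, case ladder (host summit Schanuel, cell `pub-schanuel`,
seat 2, gen 5).  Theorem F of `ZilberEacFibration.lean` asks for Zariski density of the exponential
points of `cl [Δ_d](W ∩ Gⁿ)`, a subset of the slice `{x_last = 0, y_last = 1}` of the big space
`ℂ^{d+1} × ℂ^{d+1}`.  Here we read the same condition on the honest projected variety
`S = cl pr(W ∩ Gⁿ) ⊆ ℂ^d × ℂ^d` (`pr` forgets `x_last, y_last`), the form in which Mantova–Masser's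
question and seat 1's decided instances (`EACDensityQuestion`, `EACDensityFamilies`: subsets of
`ℂ² × ℂ²`) are stated:

* `unprojectedDense_dropLastMat_of_proj`: for any `V ⊆ ℂ^{d+1} × ℂ^{d+1}`, Zariski density of the
  exponential points of `cl pr(V) ⊆ ℂ^d × ℂ^d` implies that of `cl [Δ_d](V)` (the slice
  `w' ↦ (w', 0, 1)` identifies the two closures and `1 = e^0`);
* `inter_expGraph_nonempty_of_unprojectedDense_proj` (**Theorem F′**): Theorem F with the density
  hypothesis on `cl pr(W ∩ Gⁿ)`;
* `ecCellPeriodicStdFib_of_unprojectedDense_proj`: the fibred periodic piece of `EC(d+1, d)` from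
  density on the projected `d`-folds.

HONEST FRAMING: a reduction; `EC(3,2)` OPEN; nothing here bears on Schanuel's conjecture.
-/

noncomputable section

open MvPolynomial
open Literature.NumberTheory.Transcendental Literature.ModelTheory.Zilber
open Literature.ModelTheory.ExponentialFields

set_option linter.dupNamespace false

namespace Summit.Schanuel.Schanuel.Theorems

variable {d : ℕ}

/-! ## The slice `w' ↦ (w', 0, 1)` and `[Δ_d]` -/

section Slice

variable {K : Type*} [Field K]

/-- `[Δ_d] z` is the slice point glued from the small coordinates of `z` with `x_last = 0`,
`y_last = 1`. [folklore] -/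
theorem matrixAct_dropLastMat_eq_glue (z : Fin (d + 1) ⊕ Fin (d + 1) → K) :
    matrixAct (dropLastMat d) z =
      Sum.elim (Fin.snoc (fun i => z (Sum.inl (Fin.castSucc i))) 0)
        (Fin.snoc (fun i => z (Sum.inr (Fin.castSucc i))) 1) := by
  funext j
  rcases j with k | k
  · rcases Fin.eq_castSucc_or_eq_last k with ⟨i, rfl⟩ | rfl
    · rw [Sum.elim_inl, Fin.snoc_castSucc, matrixAct_dropLastMat_inl, if_neg (Fin.castSucc_ne_last i)]
    · rw [Sum.elim_inl, Fin.snoc_last, matrixAct_dropLastMat_inl_last]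
  · rcases Fin.eq_castSucc_or_eq_last k with ⟨i, rfl⟩ | rfl
    · rw [Sum.elim_inr, Fin.snoc_castSucc, matrixAct_dropLastMat_inr, if_neg (Fin.castSucc_ne_last i)]
    · rw [Sum.elim_inr, Fin.snoc_last, matrixAct_dropLastMat_inr_last]

/-- Substituting `X_τ ↦ X_τ`, `x_last ↦ 0`, `y_last ↦ 1` and then evaluating at `w'` is evaluating at
the slice point `(w', 0, 1)`. [folklore] -/
theorem aeval_sliceSubst {F : Type*} [Field F] [Algebra F K] (w : Fin d ⊕ Fin d → K)
    (g : MvPolynomial (Fin (d + 1) ⊕ Fin (d + 1)) F) :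
    aeval w (aeval (R := F)
      (Sum.elim (Fin.snoc (fun i => X (Sum.inl i)) 0) (Fin.snoc (fun i => X (Sum.inr i)) 1) :
        Fin (d + 1) ⊕ Fin (d + 1) → MvPolynomial (Fin d ⊕ Fin d) F) g) =
      aeval (Sum.elim (Fin.snoc (fun i => w (Sum.inl i)) 0) (Fin.snoc (fun i => w (Sum.inr i)) 1) :
        Fin (d + 1) ⊕ Fin (d + 1) → K) g := by
  have hfun : (fun j => aeval w ((Sum.elim (Fin.snoc (fun i => X (Sum.inl i)) 0)
      (Fin.snoc (fun i => X (Sum.inr i)) 1) :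
        Fin (d + 1) ⊕ Fin (d + 1) → MvPolynomial (Fin d ⊕ Fin d) F) j)) =
      (Sum.elim (Fin.snoc (fun i => w (Sum.inl i)) 0) (Fin.snoc (fun i => w (Sum.inr i)) 1) :
        Fin (d + 1) ⊕ Fin (d + 1) → K) := by
    funext j
    rcases j with k | k
    · rcases Fin.eq_castSucc_or_eq_last k with ⟨i, rfl⟩ | rfl
      · rw [Sum.elim_inl, Sum.elim_inl, Fin.snoc_castSucc, Fin.snoc_castSucc, MvPolynomial.aeval_X]
      · rw [Sum.elim_inl, Sum.elim_inl, Fin.snoc_last, Fin.snoc_last, map_zero]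
    · rcases Fin.eq_castSucc_or_eq_last k with ⟨i, rfl⟩ | rfl
      · rw [Sum.elim_inr, Sum.elim_inr, Fin.snoc_castSucc, Fin.snoc_castSucc, MvPolynomial.aeval_X]
      · rw [Sum.elim_inr, Sum.elim_inr, Fin.snoc_last, Fin.snoc_last, map_one]
  rw [← AlgHom.comp_apply, MvPolynomial.comp_aeval, hfun]

end Slice

/-! ## Density passes from `cl pr(V)` to `cl [Δ_d](V)` -/

section Density

/-- **Density is intrinsic to the projected variety.**  For any `V ⊆ ℂ^{d+1} × ℂ^{d+1}`, if the
exponential points of `cl pr(V) ⊆ ℂ^d × ℂ^d` are Zariski dense (`pr` = forget `x_last, y_last`), then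
so are those of `cl [Δ_d](V) ⊆ {x_last = 0, y_last = 1}`. [folklore] -/
theorem unprojectedDense_dropLastMat_of_proj (V : Set (Fin (d + 1) ⊕ Fin (d + 1) → ℂ))
    (hdense : UnprojectedDense (zeroLocus ℂ (vanishingIdeal ℂ
      ((fun (w : Fin (d + 1) ⊕ Fin (d + 1) → ℂ) (t : Fin d ⊕ Fin d) =>
        w (Sum.map Fin.castSucc Fin.castSucc t)) '' V)))) :
    UnprojectedDense (zeroLocus ℂ (vanishingIdeal ℂ (matrixAct (dropLastMat d) '' V))) := by
  set pr : (Fin (d + 1) ⊕ Fin (d + 1) → ℂ) → (Fin d ⊕ Fin d → ℂ) :=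
    fun w t => w (Sum.map Fin.castSucc Fin.castSucc t) with hpr
  set Ssm := pr '' V with hSsm
  set Sbig := matrixAct (dropLastMat d) '' V with hSbig
  -- the slice of a small point
  have hslice : ∀ w : Fin (d + 1) ⊕ Fin (d + 1) → ℂ, matrixAct (dropLastMat d) w =
      Sum.elim (Fin.snoc (fun i => pr w (Sum.inl i)) 0) (Fin.snoc (fun i => pr w (Sum.inr i)) 1) :=
    fun w => matrixAct_dropLastMat_eq_glue w
  -- Fact 1: points of `cl Sbig` have `x_last = 0`, `y_last = 1`
  have hlast : ∀ z ∈ zeroLocus ℂ (vanishingIdeal ℂ Sbig),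
      z (Sum.inl (Fin.last d)) = 0 ∧ z (Sum.inr (Fin.last d)) = 1 := by
    intro z hz
    rw [mem_zeroLocus_iff] at hz
    constructor
    · have hX : (X (Sum.inl (Fin.last d)) : MvPolynomial _ ℂ) ∈ vanishingIdeal ℂ Sbig := by
        rw [mem_vanishingIdeal_iff]
        rintro _ ⟨w, -, rfl⟩
        rw [MvPolynomial.aeval_X, matrixAct_dropLastMat_inl_last]
      simpa only [MvPolynomial.aeval_X] using hz _ hX
    · have hX : (X (Sum.inr (Fin.last d)) - 1 : MvPolynomial _ ℂ) ∈ vanishingIdeal ℂ Sbig := by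
        rw [mem_vanishingIdeal_iff]
        rintro _ ⟨w, -, rfl⟩
        rw [map_sub, MvPolynomial.aeval_X, map_one, matrixAct_dropLastMat_inr_last, sub_self]
      have := hz _ hX
      rw [map_sub, MvPolynomial.aeval_X, map_one, sub_eq_zero] at this
      exact this
  have hglue : ∀ z ∈ zeroLocus ℂ (vanishingIdeal ℂ Sbig),
      z = Sum.elim (Fin.snoc (fun i => pr z (Sum.inl i)) 0) (Fin.snoc (fun i => pr z (Sum.inr i)) 1) := by
    intro z hz
    obtain ⟨h0, h1⟩ := hlast z hz
    rw [← h0, ← h1]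
    exact (glue_restrict_self z).symm
  -- Fact 2: `pr` maps `cl Sbig` into `cl Ssm`
  have hpr : ∀ z ∈ zeroLocus ℂ (vanishingIdeal ℂ Sbig), pr z ∈ zeroLocus ℂ (vanishingIdeal ℂ Ssm) := by
    intro z hz
    rw [mem_zeroLocus_iff]
    intro f hf
    have hren : rename (Sum.map Fin.castSucc Fin.castSucc) f ∈ vanishingIdeal ℂ Sbig := by
      rw [mem_vanishingIdeal_iff]
      rintro _ ⟨w, hw, rfl⟩
      rw [aeval_matrixAct_rename_small]
      exact (mem_vanishingIdeal_iff.1 hf) _ ⟨w, hw, rfl⟩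
    have := (mem_zeroLocus_iff.1 hz) _ hren
    rwa [aeval_rename] at this
  -- Fact 3: the slice maps `cl Ssm` into `cl Sbig`
  have hsl : ∀ w' ∈ zeroLocus ℂ (vanishingIdeal ℂ Ssm),
      (Sum.elim (Fin.snoc (fun i => w' (Sum.inl i)) 0) (Fin.snoc (fun i => w' (Sum.inr i)) 1) :
        Fin (d + 1) ⊕ Fin (d + 1) → ℂ) ∈ zeroLocus ℂ (vanishingIdeal ℂ Sbig) := by
    intro w' hw'
    rw [mem_zeroLocus_iff]
    intro h hh
    have h0 : aeval (R := ℂ) (Sum.elim (Fin.snoc (fun i => X (Sum.inl i)) 0)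
        (Fin.snoc (fun i => X (Sum.inr i)) 1) :
          Fin (d + 1) ⊕ Fin (d + 1) → MvPolynomial (Fin d ⊕ Fin d) ℂ) h ∈ vanishingIdeal ℂ Ssm := by
      rw [mem_vanishingIdeal_iff]
      rintro _ ⟨w, hw, rfl⟩
      rw [aeval_sliceSubst, ← hslice w]
      exact (mem_vanishingIdeal_iff.1 hh) _ ⟨w, hw, rfl⟩
    have := (mem_zeroLocus_iff.1 hw') _ h0
    rwa [aeval_sliceSubst] at this
  -- main inclusion
  refine le_antisymm ?_ (vanishingIdeal_anti_mono Set.inter_subset_left)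
  intro g hg
  rw [mem_vanishingIdeal_iff] at hg ⊢
  set g₀ := aeval (R := ℂ) (Sum.elim (Fin.snoc (fun i => X (Sum.inl i)) 0)
      (Fin.snoc (fun i => X (Sum.inr i)) 1) :
        Fin (d + 1) ⊕ Fin (d + 1) → MvPolynomial (Fin d ⊕ Fin d) ℂ) g with hg₀
  have hg₀mem : g₀ ∈ vanishingIdeal ℂ (zeroLocus ℂ (vanishingIdeal ℂ Ssm) ∩ expGraph ℂ d) := by
    rw [mem_vanishingIdeal_iff]
    rintro w' ⟨hw'Z, hw'Γ⟩
    rw [hg₀, aeval_sliceSubst]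
    refine hg _ ⟨hsl w' hw'Z, glue_mem_expGraph (mem_expGraph_iff.1 hw'Γ) ?_⟩
    rw [ExponentialRing.exp_zero]
  rw [hdense] at hg₀mem
  intro z hz
  rw [hglue z hz, ← aeval_sliceSubst, ← hg₀]
  exact (mem_vanishingIdeal_iff.1 hg₀mem) _ (hpr z hz)

end Density

/-! ## Theorem F′ -/

section Main

/-- **Theorem F′ (fibration principle, projected form).**  Let `W ⊆ ℂ^{d+1} × ℂ^{d+1}` be irreducible
Zariski closed, meeting the torus, of dimension `d + 1`, with `dim cl[Δ_d](W ∩ Gⁿ) = d`.  If the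
exponential points of the projected variety `cl pr(W ∩ Gⁿ) ⊆ ℂ^d × ℂ^d` are Zariski dense
(`UnprojectedDense`), then `W ∩ Γ_exp ≠ ∅`. [cite: MantovaMasser2023, §1 Further remarks] -/
theorem inter_expGraph_nonempty_of_unprojectedDense_proj {W : Set (Fin (d + 1) ⊕ Fin (d + 1) → ℂ)}
    (hW : IsIrreducibleClosed ℂ W) (hne : (W ∩ torusLocus ℂ (d + 1)).Nonempty)
    (hdim : zariskiDim ℂ W = (d + 1 : ℕ))
    (hfib : zariskiDim ℂ (matrixAct (dropLastMat d) '' (W ∩ torusLocus ℂ (d + 1))) = d)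
    (hdense : UnprojectedDense (zeroLocus ℂ (vanishingIdeal ℂ
      ((fun (w : Fin (d + 1) ⊕ Fin (d + 1) → ℂ) (t : Fin d ⊕ Fin d) =>
        w (Sum.map Fin.castSucc Fin.castSucc t)) '' (W ∩ torusLocus ℂ (d + 1)))))) :
    (W ∩ expGraph ℂ (d + 1)).Nonempty :=
  inter_expGraph_nonempty_of_unprojectedDense hW hne hdim hfib
    (unprojectedDense_dropLastMat_of_proj _ hdense)

/-- **Corollary (projected form).**  If for every irreducible `(d+1)`-fold `W` meeting the torus with
`dim cl[Δ_d](W ∩ Gⁿ) = d` the exponential points of the projected `d`-fold `cl pr(W ∩ Gⁿ)` are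
Zariski dense, then the fibred periodic piece `ECCellPeriodicStdFib d` holds. [cite: MantovaMasser2023, §1 Further remarks] -/
theorem ecCellPeriodicStdFib_of_unprojectedDense_proj (d : ℕ)
    (hdens : ∀ W : Set (Fin (d + 1) ⊕ Fin (d + 1) → ℂ), IsIrreducibleClosed ℂ W →
      (W ∩ torusLocus ℂ (d + 1)).Nonempty → zariskiDim ℂ W = (d + 1 : ℕ) →
      zariskiDim ℂ (matrixAct (dropLastMat d) '' (W ∩ torusLocus ℂ (d + 1))) = d →
      UnprojectedDense (zeroLocus ℂ (vanishingIdeal ℂ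
        ((fun (w : Fin (d + 1) ⊕ Fin (d + 1) → ℂ) (t : Fin d ⊕ Fin d) =>
          w (Sum.map Fin.castSucc Fin.castSucc t)) '' (W ∩ torusLocus ℂ (d + 1)))))) :
    ECCellPeriodicStdFib d := by
  intro W hW hne _ _ _ hdim _ _ hfib
  exact inter_expGraph_nonempty_of_unprojectedDense_proj hW hne hdim hfib (hdens W hW hne hdim hfib)

end Main

end Summit.Schanuel.Schanuel.Theorems
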